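import Mathlib
import HarnessLib
import HarnessLib.Audit
import Summits.ValiantsHypothesis.ValiantsHypothesis.Theorems.LacunarySymmetroidMatrixDescartesZeroChangeConcavityBudgetRiccati

/-!
# ValiantsHypothesis / LacunarySymmetroid — crux `MatrixDescartes` (stmt-ValiantsHypothesis-18050, V1), LINE (A) «product_plus_one»:
# the ROW WRONSKIAN has one sign change — the rise of a switched row's push is a ONE-WAY budget inside `(a, c)`

Eleventh part of the concavity budget (✓ `…Riccati`: `t·u′ = θN/g − u²` for `u = t g′/g`).  For a row `g = a₀ + a₁t^a + a₂t^c` put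
`N = t g′`, `θN = a²a₁t^a + c²a₂t^c` and the ROW WRONSKIAN `W = g·θN − N²`, so that `t·u′ = W/g²` off the roots:

* `rowWronskian_eval` — `W(t) = a²a₀a₁t^a + c²a₀a₂t^c + (c−a)²a₁a₂t^{a+c}` (three terms; for a `(+,−,−)` row the signs are `−, −, +`);
* `t_mul_deriv_logDeriv_eq` — the `u′` of ✓ `hasDerivAt_logDeriv_row` has `t·u′ = W(t)/g(t)²`: `u` increases exactly where `W ≥ 0`;
* ★ `rowWronskian_nonneg_persist` — `(+,−,−)` row (`a₀ ≥ 0 ≥ a₁, a₂`, `0 < a ≤ c`): `W(t₁) ≥ 0`, `0 < t₁ ≤ t₂` ⇒ `W(t₂) ≥ 0`.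
  ONE SIGN CHANGE: once the push `u` of a switched row starts to rise it never falls again (the row's single KNEE);
* ★ `logDeriv_lt_top_of_rowWronskian_nonneg` — on that rising regime and past the root (`g(t) < 0`, `a < c`, `a₀ > 0`): `u(t) < c`.
  With ✓ `pureT5_dip_early`'s `u > a` on switched rows: the whole rise of a switched row's push happens inside `(a, c)`, so its
  total rise is `< c − a` — the per-row RISE BUDGET of the dip mechanism (NOTE rev 3 of this hand), kernel form of «one knee per row».

HONEST FRAMING: per-row algebra, def-free, no named facts, no sorry, standard axioms; closes NO stub by name; `OneChangeFloorK3`,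
`MatrixDescartes` (stmt-ValiantsHypothesis-18050) OPEN; `VP ≠ VNP` is NOT proved and nothing here bears on it.

[folklore] Elementary algebra; no citation needed.
-/

set_option linter.dupNamespace false

namespace Summit.ValiantsHypothesis.ValiantsHypothesis.Theorems.LacunarySymmetroidMatrixDescartes

namespace ZeroChange

open Polynomial

/-- **The row Wronskian** `W = g·θN − N²` evaluated: `a²a₀a₁t^a + c²a₀a₂t^c + (c−a)²a₁a₂t^{a+c}`. -/
theorem rowWronskian_eval (a c : ℕ) (a₀ a₁ a₂ t : ℝ) :
    (row a c a₀ a₁ a₂).eval t * ((a : ℝ) ^ 2 * a₁ * t ^ a + (c : ℝ) ^ 2 * a₂ * t ^ c) -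
        (t * (derivative (row a c a₀ a₁ a₂)).eval t) ^ 2 =
      (a : ℝ) ^ 2 * a₀ * a₁ * t ^ a + (c : ℝ) ^ 2 * a₀ * a₂ * t ^ c + ((c : ℝ) - a) ^ 2 * a₁ * a₂ * t ^ (a + c) := by
  rw [mul_eval_derivative_row, eval_row, pow_add]
  ring

/-- `t·u′ = W/g²` for the derivative `u′` of `u = t g′/g` delivered by ✓ `hasDerivAt_logDeriv_row`. -/
theorem t_mul_deriv_logDeriv_eq (a c : ℕ) (a₀ a₁ a₂ : ℝ) {t : ℝ} (hg : (row a c a₀ a₁ a₂).eval t ≠ 0) :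
    ∃ u' : ℝ, HasDerivAt (fun x => x * (derivative (row a c a₀ a₁ a₂)).eval x / (row a c a₀ a₁ a₂).eval x) u' t ∧
      t * u' = ((a : ℝ) ^ 2 * a₀ * a₁ * t ^ a + (c : ℝ) ^ 2 * a₀ * a₂ * t ^ c + ((c : ℝ) - a) ^ 2 * a₁ * a₂ * t ^ (a + c)) /
        ((row a c a₀ a₁ a₂).eval t) ^ 2 := by
  obtain ⟨u', hu', htu'⟩ := hasDerivAt_logDeriv_row a c a₀ a₁ a₂ hg
  refine ⟨u', hu', ?_⟩
  rw [htu', ← rowWronskian_eval]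
  field_simp

/-- ★ **The row Wronskian's sign persists** (`(+,−,−)` row: `a₀ ≥ 0`, `a₁, a₂ ≤ 0`; `a ≤ c`): `W(t₁) ≥ 0`, `0 < t₁ ≤ t₂` ⇒ `W(t₂) ≥ 0`.
Proof: `t₁^c·W(t₂)/… = t₂^c·(W(t₁)/…) + `two manifestly nonnegative corrections — with `c = a + d`,
`t₁^{a+d}·W₂ ≥ t₂^{a+d}·W₁` term by term up to the nonnegative `A(t₂^{…} − t₁^{…})` and `B·(…)` differences. -/
theorem rowWronskian_nonneg_persist (a c : ℕ) (hac : a ≤ c) {a₀ a₁ a₂ : ℝ} (h₀ : 0 ≤ a₀) (h₁ : a₁ ≤ 0) (h₂ : a₂ ≤ 0)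
    {t₁ t₂ : ℝ} (ht₁ : 0 < t₁) (h12 : t₁ ≤ t₂)
    (hW : 0 ≤ (a : ℝ) ^ 2 * a₀ * a₁ * t₁ ^ a + (c : ℝ) ^ 2 * a₀ * a₂ * t₁ ^ c + ((c : ℝ) - a) ^ 2 * a₁ * a₂ * t₁ ^ (a + c)) :
    0 ≤ (a : ℝ) ^ 2 * a₀ * a₁ * t₂ ^ a + (c : ℝ) ^ 2 * a₀ * a₂ * t₂ ^ c + ((c : ℝ) - a) ^ 2 * a₁ * a₂ * t₂ ^ (a + c) := by
  obtain ⟨d, rfl⟩ : ∃ d, c = a + d := ⟨c - a, by omega⟩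
  have ht₂ : 0 < t₂ := lt_of_lt_of_le ht₁ h12
  -- the three nonnegative amplitudes `A = a²a₀|a₁|`, `B = c²a₀|a₂|`, `C = (c−a)²|a₁||a₂|`
  set A : ℝ := (a : ℝ) ^ 2 * a₀ * (-a₁) with hA
  set B : ℝ := ((a + d : ℕ) : ℝ) ^ 2 * a₀ * (-a₂) with hB
  set C : ℝ := (((a + d : ℕ) : ℝ) - a) ^ 2 * a₁ * a₂ with hC
  have hA0 : 0 ≤ A := mul_nonneg (mul_nonneg (sq_nonneg _) h₀) (neg_nonneg.2 h₁)
  have hB0 : 0 ≤ B := mul_nonneg (mul_nonneg (sq_nonneg _) h₀) (neg_nonneg.2 h₂)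
  have hC0 : 0 ≤ C := by
    have : 0 ≤ a₁ * a₂ := mul_nonneg_of_nonpos_of_nonpos h₁ h₂
    rw [hC, mul_assoc]; exact mul_nonneg (sq_nonneg _) this
  -- rewrite both Wronskians as `−A t^a − B t^{a+d} + C t^{2a+d}`
  have e : ∀ t : ℝ, (a : ℝ) ^ 2 * a₀ * a₁ * t ^ a + ((a + d : ℕ) : ℝ) ^ 2 * a₀ * a₂ * t ^ (a + d) +
      (((a + d : ℕ) : ℝ) - a) ^ 2 * a₁ * a₂ * t ^ (a + (a + d)) = -A * t ^ a - B * (t ^ a * t ^ d) + C * (t ^ a * t ^ a * t ^ d) := by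
    intro t; simp only [hA, hB, hC, pow_add]; ring
  rw [e] at hW ⊢
  have hp1a : 0 < t₁ ^ a := pow_pos ht₁ a
  have hp2a : 0 < t₂ ^ a := pow_pos ht₂ a
  have hp1d : 0 < t₁ ^ d := pow_pos ht₁ d
  have hp2d : 0 < t₂ ^ d := pow_pos ht₂ d
  have hda : t₁ ^ a ≤ t₂ ^ a := pow_le_pow_left₀ ht₁.le h12 a
  have hdd : t₁ ^ d ≤ t₂ ^ d := pow_le_pow_left₀ ht₁.le h12 d
  -- divide the hypothesis by `t₁^a > 0`: `C t₁^a t₁^d ≥ A + B t₁^d`; then monotonicity of each piece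
  have hW' : 0 ≤ -A - B * t₁ ^ d + C * (t₁ ^ a * t₁ ^ d) := by
    have : -A * t₁ ^ a - B * (t₁ ^ a * t₁ ^ d) + C * (t₁ ^ a * t₁ ^ a * t₁ ^ d) =
        t₁ ^ a * (-A - B * t₁ ^ d + C * (t₁ ^ a * t₁ ^ d)) := by ring
    rw [this] at hW
    exact (mul_nonneg_iff_of_pos_left hp1a).1 hW
  -- `C t₂^a t₂^d − B t₂^d = t₂^d (C t₂^a − B) ≥ t₂^d (C t₁^a − B)` and `C t₁^a − B ≥ A/t₁^d ≥ 0`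
  have hCB : 0 ≤ C * t₁ ^ a - B := by
    by_contra hneg
    have : (C * t₁ ^ a - B) * t₁ ^ d < 0 := mul_neg_of_neg_of_pos (not_le.1 hneg) hp1d
    nlinarith
  have key : -A - B * t₂ ^ d + C * (t₂ ^ a * t₂ ^ d) ≥ -A - B * t₁ ^ d + C * (t₁ ^ a * t₁ ^ d) := by
    have h1 : (C * t₁ ^ a - B) * t₁ ^ d ≤ (C * t₁ ^ a - B) * t₂ ^ d := mul_le_mul_of_nonneg_left hdd hCB
    have h2 : (C * t₁ ^ a - B) * t₂ ^ d ≤ (C * t₂ ^ a - B) * t₂ ^ d :=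
      mul_le_mul_of_nonneg_right (by nlinarith [mul_le_mul_of_nonneg_left hda hC0]) hp2d.le
    nlinarith
  have : 0 ≤ -A - B * t₂ ^ d + C * (t₂ ^ a * t₂ ^ d) := by linarith
  have final : -A * t₂ ^ a - B * (t₂ ^ a * t₂ ^ d) + C * (t₂ ^ a * t₂ ^ a * t₂ ^ d) =
      t₂ ^ a * (-A - B * t₂ ^ d + C * (t₂ ^ a * t₂ ^ d)) := by ring
  rw [final]
  exact mul_nonneg hp2a.le this

/-- ★ **On the rising regime a switched row's push stays below `c`** (`(+,−,−)` row with `a₀ > 0`, `a₁, a₂ ≤ 0`, `0 < a < c`,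
`t > 0`, past the root `g(t) < 0`): `W(t) ≥ 0 ⇒ t g′(t)/g(t) < c`. -/
theorem logDeriv_lt_top_of_rowWronskian_nonneg (a c : ℕ) (ha : 0 < a) (hac : a < c) {a₀ a₁ a₂ : ℝ} (h₀ : 0 < a₀)
    (h₁ : a₁ ≤ 0) (h₂ : a₂ ≤ 0) {t : ℝ} (ht : 0 < t) (hg : (row a c a₀ a₁ a₂).eval t < 0)
    (hW : 0 ≤ (a : ℝ) ^ 2 * a₀ * a₁ * t ^ a + (c : ℝ) ^ 2 * a₀ * a₂ * t ^ c + ((c : ℝ) - a) ^ 2 * a₁ * a₂ * t ^ (a + c)) :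
    t * (derivative (row a c a₀ a₁ a₂)).eval t / (row a c a₀ a₁ a₂).eval t < (c : ℝ) := by
  rw [mul_eval_derivative_row, div_lt_iff_of_neg hg, eval_row]
  -- goal: `c·(a₀ + a₁t^a + a₂t^c) < a·a₁t^a + c·a₂t^c`, i.e. `c·a₀ < (a−c)·a₁·t^a = (c−a)|a₁|t^a`
  have ha' : (0 : ℝ) < a := by exact_mod_cast ha
  have hc' : (0 : ℝ) < c := by exact_mod_cast (ha.trans hac)
  have hca : (0 : ℝ) < (c : ℝ) - a := by
    have : (a : ℝ) < c := by exact_mod_cast hac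
    linarith
  have hta : 0 < t ^ a := pow_pos ht a
  have htc : 0 < t ^ c := pow_pos ht c
  rw [pow_add] at hW
  -- `a₂ < 0`: otherwise `W = a²a₀a₁t^a ≤ 0` forces `a₁ = 0`, and then `g(t) = a₀ > 0`
  have h2neg : a₂ < 0 := by
    rcases lt_or_eq_of_le h₂ with h | h
    · exact h
    · exfalso
      rw [h] at hW hg
      rw [eval_row] at hg
      have hW1 : 0 ≤ (a : ℝ) ^ 2 * a₀ * a₁ * t ^ a := by simpa using hW
      have : 0 ≤ a₁ := by
        by_contra hn
        have : (a : ℝ) ^ 2 * a₀ * a₁ * t ^ a < 0 :=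
          mul_neg_of_neg_of_pos (mul_neg_of_pos_of_neg (mul_pos (pow_pos ha' 2) h₀) (not_le.1 hn)) hta
        linarith
      have h1z : a₁ = 0 := le_antisymm h₁ this
      rw [h1z] at hg
      nlinarith
  -- from `W ≥ 0`: `(c−a)²|a₁||a₂| t^a t^c ≥ c² a₀ |a₂| t^c + a² a₀ |a₁| t^a ≥ c² a₀ |a₂| t^c`, divide by `|a₂| t^c > 0`
  have hkey : (c : ℝ) ^ 2 * a₀ ≤ ((c : ℝ) - a) ^ 2 * (-a₁) * t ^ a := by
    have hpos : 0 < -a₂ * t ^ c := mul_pos (neg_pos.2 h2neg) htc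
    have h3 : 0 ≤ (a : ℝ) ^ 2 * a₀ * (-a₁) * t ^ a := by
      have := mul_nonneg (mul_nonneg (sq_nonneg (a : ℝ)) h₀.le) (neg_nonneg.2 h₁)
      exact mul_nonneg this hta.le
    -- `W = −(a²a₀|a₁|t^a) − (c²a₀)(|a₂|t^c) + ((c−a)²|a₁|t^a)(|a₂|t^c) ≥ 0`
    have hW2 : ((c : ℝ) ^ 2 * a₀) * (-a₂ * t ^ c) ≤ (((c : ℝ) - a) ^ 2 * (-a₁) * t ^ a) * (-a₂ * t ^ c) := by nlinarith
    exact le_of_mul_le_mul_right hW2 hpos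
  -- `(c−a)²|a₁|t^a ≥ c²a₀ > 0` gives `(c−a)|a₁|t^a ≥ c²a₀/(c−a) > c·a₀`
  have hc_lt : (c : ℝ) * a₀ * ((c : ℝ) - a) < (c : ℝ) ^ 2 * a₀ := by nlinarith [mul_pos hc' h₀, mul_pos ha' (mul_pos hc' h₀)]
  have hfin : (c : ℝ) * a₀ < ((c : ℝ) - a) * (-a₁) * t ^ a := by
    have h4 : (c : ℝ) * a₀ * ((c : ℝ) - a) < ((c : ℝ) - a) * ((c : ℝ) - a) * (-a₁) * t ^ a := by nlinarith
    have h5 : ((c : ℝ) - a) * ((c : ℝ) * a₀) < ((c : ℝ) - a) * (((c : ℝ) - a) * (-a₁) * t ^ a) := by nlinarith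
    exact lt_of_mul_lt_mul_left h5 hca.le
  nlinarith [mul_nonpos_iff.2 (Or.inr ⟨h₂, htc.le⟩)]

end ZeroChange

end Summit.ValiantsHypothesis.ValiantsHypothesis.Theorems.LacunarySymmetroidMatrixDescartes
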